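import Mathlib
import Summits.ResolutionOfSingularities.ResolutionOfSingularities.Theorems.WeightedInvariantLocalWeightedDropTOT2ConflictBudgetLaws

/-!
# TOT2-LINE (P3): THE REGISTERED STUB `stub_conflictBudget` OF THE ENGINE SKELETON v35 — CLOSED

ENGINE crux `stmt-ResolutionOfSingularities-8899` (`LocalWeightedDrop`), skeleton v35 (2e806da509994632), registered stub `stub_conflictBudget` (P3)
(res-type-088's object; TOT2-LINE v1.3 §3 (P3)).  [OURS · L1 W4.3 · chain w43 · res-L1-w43-stub-2 g6 (owner of (P3)), with the bricks of
res-L1-w43-stub-1 g6/g7 (B1, B3, D3, injectivity, coordinate changes, D8) and res-L1-w43-lead-1 g6 (B4); def-free; the statement below is the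
registered v35 text byte for byte; nothing here is a statement of any manuscript; AI-produced, gate-checked, weaker than expert review.]

The witness is the plane/valuative CONFLICT BUDGET `TOT2Branch.conflictBudgetD d A N` (`…TOT2ConflictBudgetDimDefs`; design
`L/res-L1-w43-stub-2/g6/CONFLICT-BUDGET-DESIGN-v1.md`): the sum over the one-dimensional non-line top-locus primes `P` of `k⟦u₁,u₂,y⟧` of the
charges `2·v_P(u₁) + β₂·(2·(v_P(u₂) − m_P) + κ(P))` plus twice the pair terms; its two laws are `TOT2Branch.conflictBudgetD_succ_law` /
`TOT2Branch.conflictBudgetD_conf_law` (`…TOT2ConflictBudgetLaws`).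
-/

set_option linter.dupNamespace false -- mandated namespace of this single-conjunct summit

noncomputable section

namespace Summit.ResolutionOfSingularities.ResolutionOfSingularities.Theorems

open MvPowerSeries

/-- **REGISTERED STUB (v35) `stub_conflictBudget` — (P3) THE CONFLICT BUDGET**, closed by the plane/valuative budget
`TOT2Branch.conflictBudgetD` (design `L/res-L1-w43-stub-2/g6/CONFLICT-BUDGET-DESIGN-v1.md`): for every prime `p` and algebraically closed `k` of
characteristic `p` there is an `ℕ`-valued function of (degree, label, `u`-boundary) which does not increase along the successor families of the
selector strategy (under the presentation context and `InPoly`) and strictly drops at conflict states along the point family. -/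
theorem stub_conflictBudget : ∀ (p : ℕ), p.Prime → ∀ (k : Type) [Field k] [CharP k p] [IsAlgClosed k],
    ∃ M : (d : ℕ) → (Fin d → MvPowerSeries (Fin 2) k) → Finset (Fin 2) → ℕ,
      (∀ (d : ℕ) (A : Fin d → MvPowerSeries (Fin 2) k) (N : Finset (Fin 2)) (A' : Fin d → MvPowerSeries (Fin 2) k) (N' : Finset (Fin 2)),
        (∃ (b : MvPowerSeries (Fin 3) k) (δ : TameFourTupleDrop.Decoration k 2) (Θ : Fin 3 → MvPowerSeries (Fin 3) k),
          TameFourTupleDrop.Admissible b δ ∧ 2 ≤ δ.o ∧ δ.c = d ∧ δ.PresBy d A N Θ) →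
        PolyDescent.InPoly d A → PolyDescent.InPoly d A' → PolyDescent.SuccFamilySel d (PolyDescent.prepSelWP d) A N A' N' →
        M d A' N' ≤ M d A N) ∧
      (∀ (d : ℕ) (A : Fin d → MvPowerSeries (Fin 2) k) (N : Finset (Fin 2)) (A' : Fin d → MvPowerSeries (Fin 2) k) (N' : Finset (Fin 2)),
        (∃ (b : MvPowerSeries (Fin 3) k) (δ : TameFourTupleDrop.Decoration k 2) (Θ : Fin 3 → MvPowerSeries (Fin 3) k),
          TameFourTupleDrop.Admissible b δ ∧ 2 ≤ δ.o ∧ δ.c = d ∧ δ.PresBy d A N Θ) →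
        PolyDescent.InPoly d A → PolyDescent.InPoly d A' → NCPoly.Conflict d A N →
        PolyDescent.PointFamilySel d (PolyDescent.prepSelWP d) A N A' N' → M d A' N' < M d A N) := by
  intro p hp k _ _ _
  haveI : Fact p.Prime := ⟨hp⟩
  refine ⟨fun d A N => TOT2Branch.conflictBudgetD d A N, ?_, ?_⟩
  · intro d A N A' N' hctx hin hin' hsel
    exact TOT2Branch.conflictBudgetD_succ_law p hctx hin hin' hsel
  · intro d A N A' N' hctx hin hin' hconf hpt
    exact TOT2Branch.conflictBudgetD_conf_law p hctx hin hin' hconf hpt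


end Summit.ResolutionOfSingularities.ResolutionOfSingularities.Theorems

end
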